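import Summits.AtomisticToContinuum.HydrodynamicLimit.Theorems.ImplosionDichotomyPolynomialCompressionExistenceReduced
import Literature.MathematicalPhysics.KineticTheory.HardSphereEulerLocalTheory

/-!
# `stub_conditionalExistence` from the two named local-theory facts (conditional closure)

Helper file for the line `log-lipschitz-budget` of the crux
`ImplosionDichotomy.PolynomialCompression` (stmt-AtomisticToContinuum-12587), stub
`stub_conditionalExistence` (Kato/Majda existence of a classical hard-sphere Euler solution on a
prescribed horizon `[0, T')` from a-priori bounds). The reduction
`hsEuler_exists_of_local_and_continuation` (`…ExistenceReduced.lean`) left exactly two published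
inputs: (a) LOCAL EXISTENCE and (b) CONTINUATION of classical solutions (Dafermos 2005,
Thm 5.1.1; Kato 1975, Thms I–II; Majda 1984, Thms 2.1–2.2), now stated in the tree's vocabulary
as the named facts `hsEuler_localExistence`, `hsEuler_continuation`
(`Literature.MathematicalPhysics.KineticTheory.HardSphereEulerLocalTheory`). This file derives
the registered signature of the stub from the two facts, taken BY NAME as hypotheses
(conditional result; its trust base is those two names):

* `stub_conditionalExistence_of_localTheory :
    hsEuler_localExistence → hsEuler_continuation → <signature of stub_conditionalExistence>`.

Proof: the three packing thresholds (of the reduction, of (a), of (b)) are replaced by their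
minimum `η₁`; (a) gives the local solution; in the reduction's continuation hypothesis the
handed-down bounds are ignored and the stub's a-priori hypothesis `hbd` (valid for every horizon
`T ≤ T'`) supplies the bounds with `η₁ ≤ η₁⁽ᵇ⁾` that (b) consumes; the reduction's own a-priori
hypothesis follows from `hbd` by `η₁ ≤ η₁⁽ʳ⁾`.
-/

namespace Summit.AtomisticToContinuum.HydrodynamicLimit.Theorems

open Set
open Literature.MathematicalPhysics.KineticTheory Literature.Analysis.FunctionSpaces

/-- **`stub_conditionalExistence`, conditionally on the named facts (a) `hsEuler_localExistence`
and (b) `hsEuler_continuation`.** Under the stub's equation-of-state hypotheses (`η₀ > 0`, `F`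
analytic on `(-η₀, η₀)`, `hsExcessFreeEnergy = F` on `[0, η₀)`, `F 0 = 0`, `F' 0 = 2π/3` — the last
two unused) there is a packing threshold `η₁ > 0` such that for every `σ > 0`, all smooth data
`ρ₀ > 0`, `θ₀ > 0`, `u₀` with `ρ₀σ³ ≤ η₁`, every horizon `T' > 0` and bound `M > 0`: if every
classical solution with the data on `[0, T)`, `T ≤ T'`, obeys the state/`C¹` bounds with
`(M, η₁)`, then a classical solution with the data exists on `[0, T')`. From
`hsEuler_exists_of_local_and_continuation` with `η₁ := min η₁⁽ʳ⁾ (min η₁⁽ᵃ⁾ η₁⁽ᵇ⁾)`. [folklore] -/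
theorem stub_conditionalExistence_of_localTheory :
    Literature.MathematicalPhysics.KineticTheory.hsEuler_localExistence →
    Literature.MathematicalPhysics.KineticTheory.hsEuler_continuation →
    ∀ η₀ : ℝ, 0 < η₀ → ∀ F : ℝ → ℝ, AnalyticOnNhd ℝ F (Ioo (-η₀) η₀) →
      EqOn hsExcessFreeEnergy F (Ico 0 η₀) → F 0 = 0 → deriv F 0 = 2 * Real.pi / 3 →
      ∃ η₁ : ℝ, 0 < η₁ ∧ ∀ σ : ℝ, 0 < σ →
        ∀ (ρ₀ θ₀ : T3 → ℝ) (u₀ : T3 → V3), Torus.IsSmooth ρ₀ → Torus.IsSmooth θ₀ →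
          Torus.IsSmooth u₀ → (∀ x, 0 < ρ₀ x) → (∀ x, 0 < θ₀ x) → (∀ x, ρ₀ x * σ ^ 3 ≤ η₁) →
          ∀ T' M : ℝ, 0 < T' → 0 < M →
            (∀ T : ℝ, T ≤ T' → ∀ (ρ θ : ℝ → T3 → ℝ) (u : ℝ → T3 → V3),
                IsHardSphereEulerSolution σ T ρ u θ → ρ 0 = ρ₀ → u 0 = u₀ → θ 0 = θ₀ →
                ∀ t ∈ Ico 0 T, ∀ x,
                  M⁻¹ ≤ ρ t x ∧ ρ t x ≤ M ∧ M⁻¹ ≤ θ t x ∧ θ t x ≤ M ∧ ‖u t x‖ ≤ M ∧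
                  ρ t x * σ ^ 3 ≤ η₁ ∧
                  ∀ i : Fin 3, ‖Torus.partialDeriv i (u t) x‖ ≤ M ∧
                    |Torus.partialDeriv i (ρ t) x| ≤ M ∧ |Torus.partialDeriv i (θ t) x| ≤ M) →
            ∃ (ρ θ : ℝ → T3 → ℝ) (u : ℝ → T3 → V3),
              IsHardSphereEulerSolution σ T' ρ u θ ∧ ρ 0 = ρ₀ ∧ u 0 = u₀ ∧ θ 0 = θ₀ := by
  intro hloc hcont η₀ hη₀ F hF hEq _hF0 _hF1
  obtain ⟨ηr, hηr, Hr⟩ := hsEuler_exists_of_local_and_continuation η₀ hη₀ F hF hEq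
  obtain ⟨ηa, hηa, Ha⟩ := hloc η₀ hη₀ F hF hEq
  obtain ⟨ηb, hηb, Hb⟩ := hcont η₀ hη₀ F hF hEq
  refine ⟨min ηr (min ηa ηb), lt_min hηr (lt_min hηa hηb), ?_⟩
  intro σ hσ ρ₀ θ₀ u₀ hρ₀ hθ₀ hu₀ hρ₀p hθ₀p hpack T' M hT' hM hbd
  have hra : min ηr (min ηa ηb) ≤ ηa := (min_le_right _ _).trans (min_le_left _ _)
  have hrb : min ηr (min ηa ηb) ≤ ηb := (min_le_right _ _).trans (min_le_right _ _)
  have hrr : min ηr (min ηa ηb) ≤ ηr := min_le_left _ _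
  refine Hr σ hσ ρ₀ θ₀ u₀ T' M hT' hM ?_ ?_ ?_
  · -- (a) local existence, packing `≤ η₁ ≤ ηa`
    exact Ha σ hσ ρ₀ θ₀ u₀ hρ₀ hθ₀ hu₀ hρ₀p hθ₀p fun x => (hpack x).trans hra
  · -- (b) continuation: the bounds come from the stub's a-priori hypothesis at horizon `T ≤ T'`
    intro T hT hTT' ρ θ u hsol hρ hu hθ _
    refine Hb σ hσ T M hT hM ρ θ u hsol fun t ht x => ?_
    obtain ⟨h1, h2, h3, h4, h5, h6, h7⟩ := hbd T hTT'.le ρ θ u hsol hρ hu hθ t ht x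
    exact ⟨h1, h2, h3, h4, h5, h6.trans hrb, h7⟩
  · -- the reduction's a-priori hypothesis at `ηr ≥ η₁`
    intro T hT ρ θ u hsol hρ hu hθ t ht x
    obtain ⟨h1, h2, h3, h4, h5, h6, h7⟩ := hbd T hT ρ θ u hsol hρ hu hθ t ht x
    exact ⟨h1, h2, h3, h4, h5, h6.trans hrr, h7⟩

end Summit.AtomisticToContinuum.HydrodynamicLimit.Theorems
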